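import Summits.BirchSwinnertonDyer.BirchSwinnertonDyer.Theorems.KolyvaginRoadThreeZhangTriangulationConfig
import HarnessLib

/-!
# Route `KolyvaginRoadThree`, deciding crux `ZhangSharpFrameAtThreeHL` (item stmt-BirchSwinnertonDyer-19574):
# W. Zhang's Lemma 8.4 (1)+(3) — TRIANGULIZATION OF THE SELMER GROUP — as a `p`-uniform kernel theorem: the axiom
# shape (A3) of the METHOD engine DERIVED from Kolyvagin-system axioms at one level
# (cell `bsd-stepL`, ACCEL seat `bsd-stepL-koly3b` g3; `--supports stmt-BirchSwinnertonDyer-19574`, helper; part 3,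
# after `KolyvaginRoadThreeZhangTriangulationBasis.lean` (data, input shapes, sliding step) and
# `KolyvaginRoadThreeZhangTriangulationConfig.lean` (the configuration `ℓ₁, …, ℓ_{2ν+1}`, `ν + 1 ≤ dim Sel^{ε_ν}`))

HONEST FRAMING. Pure linear algebra over an arbitrary field `F`; nothing about elliptic curves, Heegner points,
level raising or `p = 3` is asserted; every number-theoretic input — global reciprocity of the Tate pairing (REC),
Čebotarev in the form of Zhang's Lemma 8.1 (Cheb), the supply Lemma 8.2 (Supply), the local picture at a Kolyvagin
prime (Perf) ∕ (Line) ∕ (Iso), property (1) and (8.1) of the classes — is an explicitly named HYPOTHESIS SHAPE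
(module docstring of the `…Basis` file). 0 definitions, 0 named facts, 0 `sorry`. PARTITION: O2@3 (B10) × A1 × crux
19574 — none (composition-engine input discharged from axiom shapes; types nothing, closes nothing; T7).

WHAT THIS FILE PROVES (Zhang, Camb. J. Math. 2 (2014), Lemma 8.4, proof pp. 238–239). Let `ν` be the vanishing
order (some class on `ν` Kolyvagin primes is non-zero, every class on fewer is zero), `ε = ε₀ ^^ Nat.bodd ν` the sign
of the classes on `ν` primes, `B` ANY set of places at which every class vanishes (Zhang's base locus `B(κ)` of
Def. 8.3, or the part of it the method skeleton relaxes at — `Method2.baseLocusQ`), `Sel s` ∕ `SelRel s` the Selmer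
group of sign `s` and its relaxation at `B` (given as subspaces with the printed membership conditions). Then:

* §1 (`eq_zero_of_mem_selRel_of_loc_window_eq_zero`, p. 238–239 «Assume that c ≠ 0 … Contradiction!»): a class of
  `SelRel ε` killed by the `ν + 1` diagonal localisations `loc_{ℓ_{ν+1}}, …, loc_{ℓ_{2ν+1}}` is zero;
* §2 (`finrank_selRel_not_le`, p. 239 «it remains to show that dim Sel^{−ε_ν}_{𝔭,B(κ)} ≤ ν»): `dim SelRel (¬ε) ≤ ν`;
* §3 (`triangulation_at`, `triangulation`): `dim Sel ε = ν + 1`, `Sel ε = SelRel ε`, `dim SelRel (¬ε) ≤ ν` —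
  Lemma 8.4 (1)+(3) — and, packaged, EXACTLY the (A3) shape consumed by
  `ZhangInduction.exists_ne_zero_of_zhangInduction` ∕ `ZhangInductionOnPos…` at a level carrying a non-zero class:
  `∃ (s : Bool) (d : ℕ), finrank (Sel s) = d + 1 ∧ Sel s = SelRel s ∧ finrank (SelRel (!s)) ≤ d`.

So on the METHOD line of crux 19574 the triangulation (A3) is no longer an independent posit: at any level whose
classes `κ(·, n)` satisfy the Kolyvagin-system axioms (property (1), (8.1), alternating signs) it FOLLOWS from (REC)
(a theorem of the tree for totally complex `K`: `poitouTate_sum_localTatePairing_eq_zero_of_isTotallyComplex`),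
(Cheb), (Supply) and the local picture at Kolyvagin primes — uniformly in `p`. What it does NOT do: construct the
level-`n` classes (the R-c objects of the plan g27 ruling), prove (Cheb) ∕ (Supply) at `p = 3`, or touch the crux.

References: [cite: WZhang2014, Def. 8.3, Lemma 8.1, Lemma 8.2, Lemma 8.4 (1)–(3) and proof pp. 236–239, (8.6)–(8.7)]
[cite: McCallumLMS1991, Prop. 3.1, Lemma 5.3] [cite: GrossLMS1991, §9] [cite: Kolyvagin1991MathAnn291, Thm. 3].
-/

namespace Summit.BirchSwinnertonDyer.Rank1Residual.X11b.Three.Koly.ZhangTriangulation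

open Module Finset

variable {F : Type*} [Field F] {H : Type*} [AddCommGroup H] [Module F H]
variable {P : Type*} {Hv : P → Type*} [∀ v, AddCommGroup (Hv v)] [∀ v, Module F (Hv v)]
variable {ι : Type*}

/-! ## §1 The joint kernel of the diagonal localisations on the relaxed Selmer group is trivial -/

/-- **A relaxed Selmer class of sign `ε_ν` killed by `loc_{ℓ_{ν+1}}, …, loc_{ℓ_{2ν+1}}` is zero** (Zhang p. 238–239).
With `n' = ℓ_{ν+1} ⋯ ℓ_{2ν+1}` (`c(n') ≠ 0`, of the opposite sign), Lemma 8.1 gives `ℓ''` seeing `x` and `c(n')`;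
pairing `x` with `c(n' ℓ'')` (same sign as `x`): the terms at `B` vanish because the classes vanish there, the
terms off `B ∪ n'ℓ''` because both are Selmer there (isotropy), the terms on `n'` because `x` is killed there —
leaving the non-zero term at `ℓ''`, against reciprocity. [cite: WZhang2014, proof of Lemma 8.4 (3), (8.6)–(8.7),
pp. 238–239] [cite: McCallumLMS1991, Prop. 3.1] -/
theorem eq_zero_of_mem_selRel_of_loc_window_eq_zero [DecidableEq ι] [DecidableEq P] (E : Bool → Submodule F H)
    (loc : (v : P) → H →ₗ[F] Hv v) (b : (v : P) → Hv v →ₗ[F] Hv v →ₗ[F] F) (L : (v : P) → Submodule F (Hv v))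
    (pl : ι → P) (Fv Tv : (ℓ : ι) → Submodule F (Hv (pl ℓ))) (c : Finset ι → H) (ε₀ : Bool)
    (B : Set P) (SelRel : Bool → Submodule F H)
    (hSelRel : ∀ (s : Bool) (x : H), x ∈ SelRel s ↔ x ∈ E s ∧ ∀ v, v ∉ B → loc v x ∈ L v)
    (hB : ∀ v ∈ B, ∀ m : Finset ι, loc v (c m) = 0)
    (hpl : Function.Injective pl)
    (hLF : ∀ ℓ, L (pl ℓ) = Fv ℓ)
    (hisoL : ∀ (v : P), ∀ x ∈ L v, ∀ y ∈ L v, b v x y = 0)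
    (hperf : ∀ (ℓ : ι) (s : Bool), ∀ x ∈ E s, ∀ y ∈ E s, loc (pl ℓ) x ∈ Fv ℓ → loc (pl ℓ) x ≠ 0 →
      loc (pl ℓ) y ∈ Tv ℓ → loc (pl ℓ) y ≠ 0 → b (pl ℓ) (loc (pl ℓ) x) (loc (pl ℓ) y) ≠ 0)
    (hrec : ∀ (x y : H) (T : Finset P), (∀ v, v ∉ T → b v (loc v x) (loc v y) = 0) →
      ∑ v ∈ T, b v (loc v x) (loc v y) = 0)
    (hcE : ∀ m : Finset ι, c m ∈ E (ε₀ ^^ Nat.bodd m.card))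
    (hcL : ∀ (m : Finset ι) (v : P), (∀ ℓ ∈ m, pl ℓ ≠ v) → loc v (c m) ∈ L v)
    (hcT : ∀ (m : Finset ι), ∀ ℓ ∈ m, loc (pl ℓ) (c m) ∈ Tv ℓ)
    (hfs : ∀ (m : Finset ι) (ℓ : ι), ℓ ∉ m → (loc (pl ℓ) (c (insert ℓ m)) = 0 ↔ loc (pl ℓ) (c m) = 0))
    (hCheb2 : ∀ (s : Bool), ∀ x ∈ E s, ∀ y ∈ E (!s), x ≠ 0 → y ≠ 0 → ∀ S : Finset ι,
      ∃ ℓ, ℓ ∉ S ∧ loc (pl ℓ) x ≠ 0 ∧ loc (pl ℓ) y ≠ 0)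
    {ν : ℕ} {f : ℕ → ι} (hf : Set.InjOn f (Set.Iio (2 * ν + 1)))
    (hdiagν : loc (pl (f (ν + ν))) (c ((Finset.Ico ν (ν + ν)).image f)) ≠ 0)
    {x : H} (hx : x ∈ SelRel (ε₀ ^^ Nat.bodd ν)) (hx0 : ∀ j ≤ ν, loc (pl (f (ν + j))) x = 0) : x = 0 := by
  by_contra hxne
  have hxE : x ∈ E (ε₀ ^^ Nat.bodd ν) := ((hSelRel _ _).mp hx).1
  -- n' = {f ν, …, f (2ν)}: ν + 1 primes, c(n') ≠ 0 at f (2ν)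
  have hfresh : f (ν + ν) ∉ (Finset.Ico ν (ν + ν)).image f := fun h ↦ by
    have := (apply_mem_window_iff hf (by omega) (by omega)).mp h
    omega
  have hn'loc : loc (pl (f (ν + ν))) (c (insert (f (ν + ν)) ((Finset.Ico ν (ν + ν)).image f))) ≠ 0 :=
    fun h ↦ hdiagν ((hfs _ _ hfresh).mp h)
  have hn'0 : c (insert (f (ν + ν)) ((Finset.Ico ν (ν + ν)).image f)) ≠ 0 := fun h ↦ by
    rw [h, map_zero] at hn'loc
    exact hn'loc rfl
  have hcard' : (insert (f (ν + ν)) ((Finset.Ico ν (ν + ν)).image f)).card = ν + 1 := by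
    rw [Finset.card_insert_of_notMem hfresh, card_window hf (by omega)]
  have hn'E : c (insert (f (ν + ν)) ((Finset.Ico ν (ν + ν)).image f)) ∈ E (!(ε₀ ^^ Nat.bodd ν)) := by
    have := hcE (insert (f (ν + ν)) ((Finset.Ico ν (ν + ν)).image f))
    rwa [hcard', sign_succ] at this
  -- Lemma 8.1: ℓ'' outside f 0, …, f (2ν), seeing x and c(n')
  obtain ⟨ℓ'', hℓ''S, hℓ''x, hℓ''c⟩ :=
    hCheb2 _ x hxE _ hn'E hxne hn'0 ((Finset.range (2 * ν + 1)).image f)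
  have hℓ''n' : ℓ'' ∉ insert (f (ν + ν)) ((Finset.Ico ν (ν + ν)).image f) := by
    intro h
    rcases Finset.mem_insert.mp h with h | h
    · exact hℓ''S (Finset.mem_image.mpr ⟨ν + ν, Finset.mem_range.mpr (by omega), h.symm⟩)
    · obtain ⟨t, ht, rfl⟩ := Finset.mem_image.mp h
      exact hℓ''S (Finset.mem_image.mpr ⟨t, Finset.mem_range.mpr (by have := (Finset.mem_Ico.mp ht).2; omega), rfl⟩)
  -- n'' = n' ∪ {ℓ''}: sign of x, non-zero at ℓ''
  set n'' : Finset ι := insert ℓ'' (insert (f (ν + ν)) ((Finset.Ico ν (ν + ν)).image f)) with hn''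
  have hn''E : c n'' ∈ E (ε₀ ^^ Nat.bodd ν) := by
    have := hcE n''
    rwa [hn'', Finset.card_insert_of_notMem hℓ''n', hcard', sign_succ, sign_succ, Bool.not_not] at this
  have hyℓ'' : loc (pl ℓ'') (c n'') ≠ 0 := fun h ↦ hℓ''c ((hfs _ _ hℓ''n').mp h)
  have hℓ''B : pl ℓ'' ∉ B := fun h ↦ hℓ''c (hB _ h _)
  have hxℓ''L : loc (pl ℓ'') x ∈ Fv ℓ'' := by rw [← hLF]; exact ((hSelRel _ _).mp hx).2 _ hℓ''B
  have hterm : b (pl ℓ'') (loc (pl ℓ'') x) (loc (pl ℓ'') (c n'')) ≠ 0 :=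
    hperf ℓ'' _ x hxE _ hn''E hxℓ''L hℓ''x (hcT _ ℓ'' (Finset.mem_insert_self _ _)) hyℓ''
  -- reciprocity over n''
  have hsum : ∑ ℓ ∈ n'', b (pl ℓ) (loc (pl ℓ) x) (loc (pl ℓ) (c n'')) = 0 := by
    refine sum_pairing_eq_zero loc b pl hpl hrec x _ n'' fun v hv ↦ ?_
    by_cases hvB : v ∈ B
    · rw [hB v hvB n'', map_zero]
    · exact hisoL v _ (((hSelRel _ _).mp hx).2 v hvB) _ (hcL n'' v hv)
  rw [Finset.sum_eq_single ℓ''] at hsum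
  · exact hterm hsum
  · intro ℓ hℓ hne
    rw [hn'', Finset.mem_insert] at hℓ
    rcases hℓ with h | h
    · exact absurd h hne
    have hx0' : loc (pl ℓ) x = 0 := by
      rcases Finset.mem_insert.mp h with rfl | h
      · exact hx0 ν le_rfl
      · obtain ⟨t, ht, rfl⟩ := Finset.mem_image.mp h
        obtain ⟨j, hj, rfl⟩ : ∃ j ≤ ν, t = ν + j :=
          ⟨t - ν, by have := Finset.mem_Ico.mp ht; omega, by have := Finset.mem_Ico.mp ht; omega⟩
        exact hx0 j hj
    rw [hx0', map_zero, LinearMap.zero_apply]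
  · intro h
    exact absurd (Finset.mem_insert_self _ _) h

/-! ## §2 The opposite sign: `dim SelRel^{¬ε_ν} ≤ ν` -/

/-- **`dim Sel^{−ε_ν}_{B} ≤ ν`** (Lemma 8.4 (3), second clause, p. 239). If the relaxed Selmer group of the
opposite sign had dimension `≥ ν + 1`, the `ν` localisations `loc_{ℓ_{ν+1}}, …, loc_{ℓ_{2ν}}` — each valued on a line
— would have a common non-zero zero `d` (dimension count); Lemma 8.1 re-chooses a prime `ℓ*` seeing `d` and
`c(n_{ν+1})`, and pairing `d` with `c(n_{ν+1} ℓ*)` (same sign as `d`) leaves exactly one non-zero local term, at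
`ℓ*` — against reciprocity. [cite: WZhang2014, Lemma 8.4 (3) and proof p. 239] [cite: McCallumLMS1991, Prop. 3.1] -/
theorem finrank_selRel_not_le [DecidableEq ι] [DecidableEq P] (E : Bool → Submodule F H)
    (loc : (v : P) → H →ₗ[F] Hv v) (b : (v : P) → Hv v →ₗ[F] Hv v →ₗ[F] F) (L : (v : P) → Submodule F (Hv v))
    (pl : ι → P) (Fv Tv : (ℓ : ι) → Submodule F (Hv (pl ℓ))) (c : Finset ι → H) (ε₀ : Bool)
    (B : Set P) (SelRel : Bool → Submodule F H)
    (hSelRel : ∀ (s : Bool) (x : H), x ∈ SelRel s ↔ x ∈ E s ∧ ∀ v, v ∉ B → loc v x ∈ L v)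
    (hB : ∀ v ∈ B, ∀ m : Finset ι, loc v (c m) = 0)
    (hpl : Function.Injective pl)
    (hLF : ∀ ℓ, L (pl ℓ) = Fv ℓ)
    (hisoL : ∀ (v : P), ∀ x ∈ L v, ∀ y ∈ L v, b v x y = 0)
    (hperf : ∀ (ℓ : ι) (s : Bool), ∀ x ∈ E s, ∀ y ∈ E s, loc (pl ℓ) x ∈ Fv ℓ → loc (pl ℓ) x ≠ 0 →
      loc (pl ℓ) y ∈ Tv ℓ → loc (pl ℓ) y ≠ 0 → b (pl ℓ) (loc (pl ℓ) x) (loc (pl ℓ) y) ≠ 0)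
    (hline : ∀ (ℓ : ι) (s : Bool), ∃ e : Hv (pl ℓ), ∀ x ∈ E s, loc (pl ℓ) x ∈ Fv ℓ →
      ∃ a : F, loc (pl ℓ) x = a • e)
    (hrec : ∀ (x y : H) (T : Finset P), (∀ v, v ∉ T → b v (loc v x) (loc v y) = 0) →
      ∑ v ∈ T, b v (loc v x) (loc v y) = 0)
    (hcE : ∀ m : Finset ι, c m ∈ E (ε₀ ^^ Nat.bodd m.card))
    (hcL : ∀ (m : Finset ι) (v : P), (∀ ℓ ∈ m, pl ℓ ≠ v) → loc v (c m) ∈ L v)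
    (hcT : ∀ (m : Finset ι), ∀ ℓ ∈ m, loc (pl ℓ) (c m) ∈ Tv ℓ)
    (hfs : ∀ (m : Finset ι) (ℓ : ι), ℓ ∉ m → (loc (pl ℓ) (c (insert ℓ m)) = 0 ↔ loc (pl ℓ) (c m) = 0))
    (hCheb2 : ∀ (s : Bool), ∀ x ∈ E s, ∀ y ∈ E (!s), x ≠ 0 → y ≠ 0 → ∀ S : Finset ι,
      ∃ ℓ, ℓ ∉ S ∧ loc (pl ℓ) x ≠ 0 ∧ loc (pl ℓ) y ≠ 0)
    {ν : ℕ} [FiniteDimensional F (SelRel (!(ε₀ ^^ Nat.bodd ν)))]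
    {f : ℕ → ι} (hf : Set.InjOn f (Set.Iio (2 * ν + 1)))
    (hdiag : ∀ i ≤ ν, loc (pl (f (ν + i))) (c ((Finset.Ico i (ν + i)).image f)) ≠ 0) :
    finrank F (SelRel (!(ε₀ ^^ Nat.bodd ν))) ≤ ν := by
  by_contra hlt
  rw [not_le] at hlt
  -- the diagonal primes are off B
  have hoffB : ∀ i ≤ ν, pl (f (ν + i)) ∉ B := fun i hi h ↦ hdiag i hi (hB _ h _)
  -- dimension count along loc_{f ν}, …, loc_{f (2ν-1)}
  choose e he using hline
  set V : Submodule F H := SelRel (!(ε₀ ^^ Nat.bodd ν)) with hV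
  have hcount := finrank_le_add_finrank_inf_iInf_ker loc V (fun j ↦ pl (f (ν + j)))
    (fun j ↦ e (f (ν + j)) (!(ε₀ ^^ Nat.bodd ν))) ν fun j hj x hx ↦
      he (f (ν + j)) _ x ((hSelRel _ _).mp hx).1
        (by rw [← hLF]; exact ((hSelRel _ _).mp hx).2 _ (hoffB j (le_of_lt hj)))
  haveI : FiniteDimensional F ↥(V ⊓ ⨅ (j : ℕ) (_ : j < ν), LinearMap.ker (loc (pl (f (ν + j))))) :=
    Submodule.finiteDimensional_of_le inf_le_left
  have hpos : 0 < finrank F ↥(V ⊓ ⨅ (j : ℕ) (_ : j < ν), LinearMap.ker (loc (pl (f (ν + j))))) := by omega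
  obtain ⟨⟨d, hd⟩, hd0⟩ := finrank_pos_iff_exists_ne_zero.mp hpos
  have hd0' : d ≠ 0 := fun h ↦ hd0 (Subtype.ext h)
  have hdV : d ∈ V := (Submodule.mem_inf.mp hd).1
  have hdker : ∀ j < ν, loc (pl (f (ν + j))) d = 0 := fun j hj ↦
    LinearMap.mem_ker.mp ((Submodule.mem_iInf _).mp ((Submodule.mem_iInf _).mp (Submodule.mem_inf.mp hd).2 j) hj)
  have hdE : d ∈ E (!(ε₀ ^^ Nat.bodd ν)) := ((hSelRel _ _).mp hdV).1
  -- y = c(n_{ν+1}) of sign ε, non-zero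
  have hyE : c ((Finset.Ico ν (ν + ν)).image f) ∈ E (!!(ε₀ ^^ Nat.bodd ν)) := by
    rw [Bool.not_not]
    have hcw : ((Finset.Ico ν (ν + ν)).image f).card = ν := card_window hf (by omega)
    have := hcE ((Finset.Ico ν (ν + ν)).image f)
    rwa [hcw] at this
  have hy0 : c ((Finset.Ico ν (ν + ν)).image f) ≠ 0 := fun h ↦ by
    have := hdiag ν le_rfl
    rw [h, map_zero] at this
    exact this rfl
  -- Lemma 8.1: re-choose ℓ* outside f 0, …, f (2ν - 1)
  obtain ⟨ℓ', hℓ'S, hℓ'd, hℓ'y⟩ := hCheb2 _ d hdE _ hyE hd0' hy0 ((Finset.range (ν + ν)).image f)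
  have hℓ'W : ℓ' ∉ (Finset.Ico ν (ν + ν)).image f := by
    intro h
    obtain ⟨t, ht, rfl⟩ := Finset.mem_image.mp h
    exact hℓ'S (Finset.mem_image.mpr ⟨t, Finset.mem_range.mpr (Finset.mem_Ico.mp ht).2, rfl⟩)
  set nS : Finset ι := insert ℓ' ((Finset.Ico ν (ν + ν)).image f) with hnS
  have hnSE : c nS ∈ E (!(ε₀ ^^ Nat.bodd ν)) := by
    have := hcE nS
    rwa [hnS, Finset.card_insert_of_notMem hℓ'W, card_window hf (by omega), sign_succ] at this
  have hyℓ' : loc (pl ℓ') (c nS) ≠ 0 := fun h ↦ hℓ'y ((hfs _ _ hℓ'W).mp h)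
  have hℓ'B : pl ℓ' ∉ B := fun h ↦ hℓ'y (hB _ h _)
  have hdℓ'L : loc (pl ℓ') d ∈ Fv ℓ' := by rw [← hLF]; exact ((hSelRel _ _).mp hdV).2 _ hℓ'B
  have hterm : b (pl ℓ') (loc (pl ℓ') d) (loc (pl ℓ') (c nS)) ≠ 0 :=
    hperf ℓ' _ d hdE _ hnSE hdℓ'L hℓ'd (hcT _ ℓ' (Finset.mem_insert_self _ _)) hyℓ'
  have hsum : ∑ ℓ ∈ nS, b (pl ℓ) (loc (pl ℓ) d) (loc (pl ℓ) (c nS)) = 0 := by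
    refine sum_pairing_eq_zero loc b pl hpl hrec d _ nS fun v hv ↦ ?_
    by_cases hvB : v ∈ B
    · rw [hB v hvB nS, map_zero]
    · exact hisoL v _ (((hSelRel _ _).mp hdV).2 v hvB) _ (hcL nS v hv)
  rw [Finset.sum_eq_single ℓ'] at hsum
  · exact hterm hsum
  · intro ℓ hℓ hne
    rw [hnS, Finset.mem_insert] at hℓ
    rcases hℓ with h | h
    · exact absurd h hne
    obtain ⟨t, ht, rfl⟩ := Finset.mem_image.mp h
    obtain ⟨j, hj, rfl⟩ : ∃ j < ν, t = ν + j :=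
      ⟨t - ν, by have := Finset.mem_Ico.mp ht; omega, by have := Finset.mem_Ico.mp ht; omega⟩
    rw [hdker j hj, map_zero, LinearMap.zero_apply]
  · intro h
    exact absurd (Finset.mem_insert_self _ _) h

/-! ## §3 Lemma 8.4 (1)+(3): the (A3) shape -/

/-- **Zhang's Lemma 8.4 (1)+(3) at the vanishing order `ν`.** Data of one level and input shapes as in
`KolyvaginRoadThreeZhangTriangulationBasis.lean`; `B` any set of places where every class vanishes, `Sel s` ∕
`SelRel s` subspaces with the printed membership (Selmer of sign `s`; relaxed at `B`), `SelRel s` finite-dimensional.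
If some class on `ν` primes is non-zero and every class on fewer primes vanishes, then with `ε = ε₀ ^^ Nat.bodd ν`:
`dim Sel ε = ν + 1`, `Sel ε = SelRel ε`, and `dim SelRel (¬ε) ≤ ν`. Assembly: `ν + 1 ≤ dim Sel ε` (triangular
basis, `succ_le_finrank_sel`) `≤ dim SelRel ε ≤ (ν + 1) + dim (joint kernel) = ν + 1` (dimension count + §1), and §2.
CONDITIONAL on every input shape; uniform in `F`. [cite: WZhang2014, Lemma 8.4 (1)–(3), pp. 236–239] -/
theorem triangulation_at [DecidableEq ι] [DecidableEq P] (E : Bool → Submodule F H)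
    (loc : (v : P) → H →ₗ[F] Hv v) (b : (v : P) → Hv v →ₗ[F] Hv v →ₗ[F] F) (L : (v : P) → Submodule F (Hv v))
    (pl : ι → P) (Fv Tv : (ℓ : ι) → Submodule F (Hv (pl ℓ))) (c : Finset ι → H) (ε₀ : Bool)
    (B : Set P) (Sel SelRel : Bool → Submodule F H)
    (hSel : ∀ (s : Bool) (x : H), x ∈ Sel s ↔ x ∈ E s ∧ ∀ v, loc v x ∈ L v)
    (hSelRel : ∀ (s : Bool) (x : H), x ∈ SelRel s ↔ x ∈ E s ∧ ∀ v, v ∉ B → loc v x ∈ L v)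
    (hfin : ∀ s, FiniteDimensional F (SelRel s))
    (hB : ∀ v ∈ B, ∀ m : Finset ι, loc v (c m) = 0)
    (hpl : Function.Injective pl)
    (hLF : ∀ ℓ, L (pl ℓ) = Fv ℓ)
    (hisoL : ∀ (v : P), ∀ x ∈ L v, ∀ y ∈ L v, b v x y = 0)
    (hisoT : ∀ (ℓ : ι), ∀ x ∈ Tv ℓ, ∀ y ∈ Tv ℓ, b (pl ℓ) x y = 0)
    (hperf : ∀ (ℓ : ι) (s : Bool), ∀ x ∈ E s, ∀ y ∈ E s, loc (pl ℓ) x ∈ Fv ℓ → loc (pl ℓ) x ≠ 0 →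
      loc (pl ℓ) y ∈ Tv ℓ → loc (pl ℓ) y ≠ 0 → b (pl ℓ) (loc (pl ℓ) x) (loc (pl ℓ) y) ≠ 0)
    (hline : ∀ (ℓ : ι) (s : Bool), ∃ e : Hv (pl ℓ), ∀ x ∈ E s, loc (pl ℓ) x ∈ Fv ℓ →
      ∃ a : F, loc (pl ℓ) x = a • e)
    (hrec : ∀ (x y : H) (T : Finset P), (∀ v, v ∉ T → b v (loc v x) (loc v y) = 0) →
      ∑ v ∈ T, b v (loc v x) (loc v y) = 0)
    (hcE : ∀ m : Finset ι, c m ∈ E (ε₀ ^^ Nat.bodd m.card))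
    (hcL : ∀ (m : Finset ι) (v : P), (∀ ℓ ∈ m, pl ℓ ≠ v) → loc v (c m) ∈ L v)
    (hcT : ∀ (m : Finset ι), ∀ ℓ ∈ m, loc (pl ℓ) (c m) ∈ Tv ℓ)
    (hfs : ∀ (m : Finset ι) (ℓ : ι), ℓ ∉ m → (loc (pl ℓ) (c (insert ℓ m)) = 0 ↔ loc (pl ℓ) (c m) = 0))
    (hCheb1 : ∀ x : H, x ≠ 0 → ∀ S : Finset ι, ∃ ℓ, ℓ ∉ S ∧ loc (pl ℓ) x ≠ 0)
    (hCheb2 : ∀ (s : Bool), ∀ x ∈ E s, ∀ y ∈ E (!s), x ≠ 0 → y ≠ 0 → ∀ S : Finset ι,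
      ∃ ℓ, ℓ ∉ S ∧ loc (pl ℓ) x ≠ 0 ∧ loc (pl ℓ) y ≠ 0)
    (hSupply : ∀ (ℓ : ι) (S : Finset ι), ℓ ∉ S → ∀ s : Bool, ∃ x ∈ E s, x ≠ 0 ∧
      (∀ v : P, v ≠ pl ℓ → (∀ ℓ' ∈ S, pl ℓ' ≠ v) → loc v x ∈ L v) ∧ ∀ ℓ' ∈ S, loc (pl ℓ') x ∈ Tv ℓ')
    {ν : ℕ} (hν : ∃ m : Finset ι, m.card = ν ∧ c m ≠ 0) (hmin : ∀ m : Finset ι, m.card < ν → c m = 0) :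
    finrank F (Sel (ε₀ ^^ Nat.bodd ν)) = ν + 1 ∧ Sel (ε₀ ^^ Nat.bodd ν) = SelRel (ε₀ ^^ Nat.bodd ν) ∧
      finrank F (SelRel (!(ε₀ ^^ Nat.bodd ν))) ≤ ν := by
  haveI := hfin (ε₀ ^^ Nat.bodd ν)
  haveI := hfin (!(ε₀ ^^ Nat.bodd ν))
  -- Sel ≤ SelRel
  have hle : Sel (ε₀ ^^ Nat.bodd ν) ≤ SelRel (ε₀ ^^ Nat.bodd ν) := fun x hx ↦
    (hSelRel _ _).mpr ⟨((hSel _ _).mp hx).1, fun v _ ↦ ((hSel _ _).mp hx).2 v⟩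
  haveI : FiniteDimensional F (Sel (ε₀ ^^ Nat.bodd ν)) := Submodule.finiteDimensional_of_le hle
  -- the configuration ℓ₁, …, ℓ_{2ν+1}
  obtain ⟨f, hf, hdiag⟩ := exists_configuration E loc b L pl Fv Tv c ε₀ hpl hLF hisoL hisoT hperf hrec hcE hcL
    hcT hfs hCheb1 hCheb2 hSupply hν
  -- ν + 1 ≤ dim Sel ε
  have h1 : ν + 1 ≤ finrank F (Sel (ε₀ ^^ Nat.bodd ν)) :=
    succ_le_finrank_sel E loc L pl c ε₀ Sel hSel hcE hcL hfs hmin hf hdiag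
  -- dim SelRel ε ≤ ν + 1: dimension count along the diagonal localisations, joint kernel trivial
  have hoffB : ∀ i ≤ ν, pl (f (ν + i)) ∉ B := fun i hi h ↦ hdiag i hi (hB _ h _)
  choose e he using hline
  have hcount := finrank_le_add_finrank_inf_iInf_ker loc (SelRel (ε₀ ^^ Nat.bodd ν)) (fun j ↦ pl (f (ν + j)))
    (fun j ↦ e (f (ν + j)) (ε₀ ^^ Nat.bodd ν)) (ν + 1) fun j hj x hx ↦
      he (f (ν + j)) _ x ((hSelRel _ _).mp hx).1
        (by rw [← hLF]; exact ((hSelRel _ _).mp hx).2 _ (hoffB j (Nat.lt_succ_iff.mp hj)))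
  have hbot : (SelRel (ε₀ ^^ Nat.bodd ν) ⊓ ⨅ (j : ℕ) (_ : j < ν + 1), LinearMap.ker (loc (pl (f (ν + j))))) = ⊥ := by
    refine (Submodule.eq_bot_iff _).mpr fun x hx ↦ ?_
    refine eq_zero_of_mem_selRel_of_loc_window_eq_zero E loc b L pl Fv Tv c ε₀ B SelRel hSelRel hB hpl hLF hisoL
      hperf hrec hcE hcL hcT hfs hCheb2 hf (hdiag ν le_rfl) (Submodule.mem_inf.mp hx).1 fun j hj ↦ ?_
    exact LinearMap.mem_ker.mp
      ((Submodule.mem_iInf _).mp ((Submodule.mem_iInf _).mp (Submodule.mem_inf.mp hx).2 j) (Nat.lt_succ_iff.mpr hj))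
  rw [hbot, finrank_bot, add_zero] at hcount
  have h3 : finrank F (Sel (ε₀ ^^ Nat.bodd ν)) ≤ finrank F (SelRel (ε₀ ^^ Nat.bodd ν)) := Submodule.finrank_mono hle
  refine ⟨by omega, Submodule.eq_of_le_of_finrank_le hle (by omega), ?_⟩
  exact finrank_selRel_not_le E loc b L pl Fv Tv c ε₀ B SelRel hSelRel hB hpl hLF hisoL hperf
    (fun ℓ s ↦ ⟨e ℓ s, he ℓ s⟩) hrec hcE hcL hcT hfs hCheb2 hf hdiag

/-- **The axiom shape (A3) TRIANGULATION of the METHOD engine, DERIVED** (the conclusion is, verbatim, the shape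
`∃ (s : Bool) (d : ℕ), finrank F (Sel s) = d + 1 ∧ Sel s = SelRel s ∧ finrank F (SelRel (!s)) ≤ d` consumed at a
level carrying a non-zero class by `ZhangInduction.exists_ne_zero_of_zhangInduction` (hypothesis `hA3`, with
`Sel := Sel n`, `SelRel := SelRel n (B n)`) and by `ZhangInductionOnPos.…`): if SOME class is non-zero — the trigger
`(∃ m, κ m n ≠ 0)` of (A3) — take `ν` the vanishing order and apply `triangulation_at`. So, at any level whose classes
satisfy the Kolyvagin-system axioms, (A3) follows from (REC) + (Cheb) + (Supply) + the local picture at Kolyvagin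
primes, uniformly in the field of coefficients. CONDITIONAL on every input shape; nothing is booked.
[cite: WZhang2014, Lemma 8.4 (1)+(3)] [cite: McCallumLMS1991, Prop. 3.1, Lemma 5.3] -/
theorem triangulation [DecidableEq ι] [DecidableEq P] (E : Bool → Submodule F H)
    (loc : (v : P) → H →ₗ[F] Hv v) (b : (v : P) → Hv v →ₗ[F] Hv v →ₗ[F] F) (L : (v : P) → Submodule F (Hv v))
    (pl : ι → P) (Fv Tv : (ℓ : ι) → Submodule F (Hv (pl ℓ))) (c : Finset ι → H) (ε₀ : Bool)
    (B : Set P) (Sel SelRel : Bool → Submodule F H)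
    (hSel : ∀ (s : Bool) (x : H), x ∈ Sel s ↔ x ∈ E s ∧ ∀ v, loc v x ∈ L v)
    (hSelRel : ∀ (s : Bool) (x : H), x ∈ SelRel s ↔ x ∈ E s ∧ ∀ v, v ∉ B → loc v x ∈ L v)
    (hfin : ∀ s, FiniteDimensional F (SelRel s))
    (hB : ∀ v ∈ B, ∀ m : Finset ι, loc v (c m) = 0)
    (hpl : Function.Injective pl)
    (hLF : ∀ ℓ, L (pl ℓ) = Fv ℓ)
    (hisoL : ∀ (v : P), ∀ x ∈ L v, ∀ y ∈ L v, b v x y = 0)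
    (hisoT : ∀ (ℓ : ι), ∀ x ∈ Tv ℓ, ∀ y ∈ Tv ℓ, b (pl ℓ) x y = 0)
    (hperf : ∀ (ℓ : ι) (s : Bool), ∀ x ∈ E s, ∀ y ∈ E s, loc (pl ℓ) x ∈ Fv ℓ → loc (pl ℓ) x ≠ 0 →
      loc (pl ℓ) y ∈ Tv ℓ → loc (pl ℓ) y ≠ 0 → b (pl ℓ) (loc (pl ℓ) x) (loc (pl ℓ) y) ≠ 0)
    (hline : ∀ (ℓ : ι) (s : Bool), ∃ e : Hv (pl ℓ), ∀ x ∈ E s, loc (pl ℓ) x ∈ Fv ℓ →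
      ∃ a : F, loc (pl ℓ) x = a • e)
    (hrec : ∀ (x y : H) (T : Finset P), (∀ v, v ∉ T → b v (loc v x) (loc v y) = 0) →
      ∑ v ∈ T, b v (loc v x) (loc v y) = 0)
    (hcE : ∀ m : Finset ι, c m ∈ E (ε₀ ^^ Nat.bodd m.card))
    (hcL : ∀ (m : Finset ι) (v : P), (∀ ℓ ∈ m, pl ℓ ≠ v) → loc v (c m) ∈ L v)
    (hcT : ∀ (m : Finset ι), ∀ ℓ ∈ m, loc (pl ℓ) (c m) ∈ Tv ℓ)
    (hfs : ∀ (m : Finset ι) (ℓ : ι), ℓ ∉ m → (loc (pl ℓ) (c (insert ℓ m)) = 0 ↔ loc (pl ℓ) (c m) = 0))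
    (hCheb1 : ∀ x : H, x ≠ 0 → ∀ S : Finset ι, ∃ ℓ, ℓ ∉ S ∧ loc (pl ℓ) x ≠ 0)
    (hCheb2 : ∀ (s : Bool), ∀ x ∈ E s, ∀ y ∈ E (!s), x ≠ 0 → y ≠ 0 → ∀ S : Finset ι,
      ∃ ℓ, ℓ ∉ S ∧ loc (pl ℓ) x ≠ 0 ∧ loc (pl ℓ) y ≠ 0)
    (hSupply : ∀ (ℓ : ι) (S : Finset ι), ℓ ∉ S → ∀ s : Bool, ∃ x ∈ E s, x ≠ 0 ∧
      (∀ v : P, v ≠ pl ℓ → (∀ ℓ' ∈ S, pl ℓ' ≠ v) → loc v x ∈ L v) ∧ ∀ ℓ' ∈ S, loc (pl ℓ') x ∈ Tv ℓ')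
    (hne : ∃ m : Finset ι, c m ≠ 0) :
    ∃ (s : Bool) (d : ℕ), finrank F (Sel s) = d + 1 ∧ Sel s = SelRel s ∧ finrank F (SelRel (!s)) ≤ d := by
  classical
  -- the vanishing order
  have hex : ∃ k : ℕ, ∃ m : Finset ι, m.card = k ∧ c m ≠ 0 := by
    obtain ⟨m, hm⟩ := hne
    exact ⟨m.card, m, rfl, hm⟩
  refine ⟨ε₀ ^^ Nat.bodd (Nat.find hex), Nat.find hex, ?_⟩
  have hν : ∃ m : Finset ι, m.card = Nat.find hex ∧ c m ≠ 0 := Nat.find_spec hex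
  have hmin : ∀ m : Finset ι, m.card < Nat.find hex → c m = 0 := by
    intro m hm
    by_contra h
    exact Nat.find_min hex hm ⟨m, rfl, h⟩
  exact triangulation_at E loc b L pl Fv Tv c ε₀ B Sel SelRel hSel hSelRel hfin hB hpl hLF hisoL hisoT hperf hline
    hrec hcE hcL hcT hfs hCheb1 hCheb2 hSupply hν hmin

end Summit.BirchSwinnertonDyer.Rank1Residual.X11b.Three.Koly.ZhangTriangulation
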